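import Summits.ABC.IUTFork.Cor312GenuineKWildDifferentUpper
import Literature.IUT.LogVolume.UnitRadicalDifferentExact
import HarnessLib

/-!
# [IUTchIII] Cor. 3.12, branch C / R-W window table — the WILD different at the `K`-level pilot datum, EXACT at EVERY pole type:
# W2 (`p ∣ t`, `v_p(u^{p−1} − 1) = 1`): `d(K_{x₀}) = (e + e/p − 1)/e`; SPLIT (`p ∣ t`, `u^{p−1} ≡ 1 (mod p²)`): `d(K_{x₀}) = (e − 1)/e`
# (W1, `p ∤ t`: `d(K_{x₀}) = (2e − 1)/e` is `GenuineK.differentOrd_kOf_eq_wild_ratPoint`, `Cor312GenuineKWildDifferentUpper`)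

PROOF-ONLY support file (D-0012; 0 definitions, 0 `Prop` facts) of the abc-iut cell (R-W «WINDOW Θ-SIDE INEQUALITY», seat
abc-iut-w5-d180 gen 10, row «W:W2-DIFFERENT-EXACT»; GAP G-Wnum2-1 (ii) — CLOSED two-sided at every wild packet type with this file).
TAKES NO SIDE on [IUTchIII] Cor. 3.12 (S. Mochizuki, *Inter-universal Teichmüller theory III*, Cor. 3.12 p. 173–174) or on any author.

Inputs BY NAME: abc-iut-W-neg-1's unit radical at a `p ∣ t` pole (`GenuineK.exists_pow_prime_eq_unit_kOf_ratPoint`), its W2 lower bound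
(`GenuineK.add_div_sub_one_div_le_differentOrd_kOf_wildUnit_ratPoint`: `(e + e/p − 1)/e ≤ d`), its exact types
(`…absRamificationIdx_kOf_eq_wildSplit_ratPoint`, `…_wild_ite_ratPoint`), the Fermat split
`GenuineK.padicValRat_pow_sub_one_sub_one_of_padicValRat_eq_zero`, and this seat's abstract W2 upper bound
`Literature.IUT.LogVolume.differentOrd_le_of_pow_prime_eq_unit` (`K ∋ u^{1/p}`, `‖u^{p−1} − 1‖ = p⁻¹`, `p² ∤ e ⇒ d ≤ (e + e/p − 1)/e`;
Euler's `g′(x) ∈ 𝔇` on `ℚ_p(u^{(p−1)/p} − 1)` and the tame equality of [IUTchIV] Prop. 1.3 (i); `UnitRadicalDifferentExact`) together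
with `v_p(e) ≤ 1` (`GenuineK.padicValNat_absRamificationIdx_kOf_le_one_ratPoint`). For `T : Cor22.ThetaVolumeDatumAt (ratPoint q₀) l`,
`{p, p′} = {3, 5}`, `p ≠ l`, a pole of `j(q₀)` of order `2t` with `p ∣ t`, `u = j(q₀)⁻¹/p^{2t}`, and EVERY fibre point `x₀ ∣ p`:

* §1 **`GenuineK.differentOrd_kOf_eq_wildUnit_ratPoint`** — W2 (`v_p(u^{p−1} − 1) = 1`): `d(K_{x₀}) = (e + e/p − 1)/e` EXACTLY
  (`= 4/3 − 1/e` at `p = 3`, `6/5 − 1/e` at `p = 5`); global `GenuineK.multiplicity_differentIdeal_placeOf_eq_wildUnit_ratPoint` —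
  `ord_u 𝔇_{K/ℤ} = e(u|p) + e(u|p)/p − 1` at `u = placeOf x₀`;
* §2 **`GenuineK.differentOrd_kOf_eq_wildSplit_ratPoint`** — SPLIT (`u^{p−1} = 1 ∨ v_p(u^{p−1} − 1) ≥ 2`): `p ∤ e`, `d(K_{x₀}) = (e − 1)/e`
  (tame, Serre III §6 Prop. 13); global `…multiplicity_differentIdeal_placeOf_eq_wildSplit_ratPoint` — `ord_u 𝔇_{K/ℤ} = e(u|p) − 1`;
* §3 **`GenuineK.mul_differentOrd_kOf_eq_wild_ite_ratPoint`** — at a `p ∣ t` pole, DECIDED by one congruence: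
  `e·d(K_{x₀}) = if v_p(u^{p−1} − 1) = 1 then e + e/p − 1 else e − 1` (the W-num-2 N1-WILD-EXACT table `δ_w` in the kernel).

HONEST FRAMING: bookkeeping over OUR typed objects (classical Tate-curve and local-field theory); nothing here bears on the printed inequality
of [IUTchIII] Cor. 3.12 or on the number-level `Cor22.Cor312AtDatum`; typed ≠ proved; instantiated ≠ endorsed; no abc claim.
[cite: SerreLocalFields1979, Ch. III §4 Prop. 10, §6 Prop. 13; Cor. 2 of Prop. 11] [cite: Serre1973, Ch. II §3.3]
[cite: Mochizuki2012, IUTchIV Prop. 1.3 (i) p. 11, Thm. 1.10 p. 22] [claim: Mochizuki2012, status: disputed] for every IUT quotation.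
-/

noncomputable section

open NumberField IsDedekindDomain

namespace Summit.ABC.IUTFork.Conditional

open Thm311 Thm311.Real Cor312 Cor312Prov Literature.IUT.LogVolume Literature.IUT.HodgeTheaters
  Literature.IUT.LogThetaLattice Literature.NumberTheory.NumberFields Literature.NumberTheory.DiophantineGeometry.GenEll
  Literature.NumberTheory.DiophantineGeometry

/-! ## 0. The unit criterion transferred from the rational number `w = j⁻¹p^{−2t}` to `u ∈ ℚ_p` (adapted from
abc-iut-W-neg-1's private lemmas of `Cor312GenuineKWildDifferentUnit`) -/

/-- If `‖u − w‖ ≤ p⁻²` and `‖w^{p−1} − 1‖ = p⁻¹` (`w`, `u` units) then `‖u^{p−1} − 1‖ = p⁻¹` (`u^{p−1} − w^{p−1} = (u − w)·Σ uⁱw^{p−2−i}` has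
norm `≤ p⁻²`). (Adapted from abc-iut-W-neg-1, `Cor312GenuineKWildDifferentUnit`.) [folklore] -/
private theorem norm_pow_sub_one_eq_of_norm_sub_le' {p : ℕ} [Fact p.Prime] {u w : ℚ_[p]} (hw1 : ‖w‖ ≤ 1)
    (huw : ‖u - w‖ ≤ (p : ℝ)⁻¹ * (p : ℝ)⁻¹) (hw : ‖w ^ (p - 1) - 1‖ = (p : ℝ)⁻¹) :
    ‖u ^ (p - 1) - 1‖ = (p : ℝ)⁻¹ := by
  have hp1 : (1 : ℝ) < p := by exact_mod_cast (Fact.out : p.Prime).one_lt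
  have hpinv : (p : ℝ)⁻¹ < 1 := inv_lt_one_of_one_lt₀ hp1
  have hpinv0 : (0 : ℝ) < (p : ℝ)⁻¹ := by positivity
  have hu1 : ‖u‖ ≤ 1 := by
    have h : u = (u - w) + w := by ring
    rw [h]
    exact (IsUltrametricDist.norm_add_le_max _ _).trans
      (max_le (huw.trans (mul_le_one₀ hpinv.le hpinv0.le hpinv.le)) hw1)
  have hgeom : (∑ i ∈ Finset.range (p - 1), u ^ i * w ^ (p - 1 - 1 - i)) * (u - w) = u ^ (p - 1) - w ^ (p - 1) :=
    (Commute.all u w).geom_sum₂_mul (p - 1)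
  have hdiff : ‖u ^ (p - 1) - w ^ (p - 1)‖ ≤ (p : ℝ)⁻¹ * (p : ℝ)⁻¹ := by
    rw [← hgeom, norm_mul]
    have hs : ‖∑ i ∈ Finset.range (p - 1), u ^ i * w ^ (p - 1 - 1 - i)‖ ≤ 1 := by
      refine IsUltrametricDist.norm_sum_le_of_forall_le_of_nonneg zero_le_one fun i _ => ?_
      rw [norm_mul, norm_pow, norm_pow]
      exact mul_le_one₀ (pow_le_one₀ (norm_nonneg _) hu1) (by positivity) (pow_le_one₀ (norm_nonneg _) hw1)
    calc _ ≤ 1 * ((p : ℝ)⁻¹ * (p : ℝ)⁻¹) := mul_le_mul hs huw (norm_nonneg _) zero_le_one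
      _ = _ := one_mul _
  have hlt : ‖u ^ (p - 1) - w ^ (p - 1)‖ < ‖w ^ (p - 1) - 1‖ := by
    rw [hw]
    calc _ ≤ (p : ℝ)⁻¹ * (p : ℝ)⁻¹ := hdiff
      _ < (p : ℝ)⁻¹ * 1 := by gcongr
      _ = _ := mul_one _
  have hsplit : u ^ (p - 1) - 1 = (u ^ (p - 1) - w ^ (p - 1)) + (w ^ (p - 1) - 1) := by ring
  rw [hsplit, IsUltrametricDist.norm_add_eq_max_of_norm_ne_norm hlt.ne, max_eq_right hlt.le, hw]

/-- `‖u‖ = 1`, `‖u − w‖ ≤ p⁻²`, `v_p(w^{p−1} − 1) = 1` for a rational `w` ⇒ `‖u^{p−1} − 1‖ = p⁻¹`.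
(Adapted from abc-iut-W-neg-1, `Cor312GenuineKWildDifferentUnit`.) [folklore] -/
private theorem norm_pow_sub_one_eq_of_norm_sub_le_of_padicValRat' (p : ℕ) [Fact p.Prime] {u : ℚ_[p]} {w : ℚ}
    (hu1 : ‖u‖ = 1) (huw : ‖u - (w : ℚ_[p])‖ ≤ (p : ℝ)⁻¹ * (p : ℝ)⁻¹)
    (hunit : padicValRat p (w ^ (p - 1) - 1) = 1) :
    ‖u ^ (p - 1) - 1‖ = (p : ℝ)⁻¹ := by
  have hp1 : (1 : ℝ) < p := by exact_mod_cast (Fact.out : p.Prime).one_lt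
  have hpinv : (p : ℝ)⁻¹ < 1 := inv_lt_one_of_one_lt₀ hp1
  have hpinv0 : (0 : ℝ) < (p : ℝ)⁻¹ := by positivity
  have hw1 : ‖(w : ℚ_[p])‖ ≤ 1 := by
    have h : (w : ℚ_[p]) = u + -(u - w) := by ring
    rw [h]
    refine (IsUltrametricDist.norm_add_le_max _ _).trans (max_le hu1.le ?_)
    rw [norm_neg]
    exact huw.trans (mul_le_one₀ hpinv.le hpinv0.le hpinv.le)
  have hr0 : w ^ (p - 1) - 1 ≠ 0 := by
    intro h0
    rw [h0, padicValRat.zero] at hunit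
    exact zero_ne_one hunit
  have hw : ‖(w : ℚ_[p]) ^ (p - 1) - 1‖ = (p : ℝ)⁻¹ := by
    have hcast : (w : ℚ_[p]) ^ (p - 1) - 1 = ((w ^ (p - 1) - 1 : ℚ) : ℚ_[p]) := by push_cast; ring
    rw [hcast, Padic.norm_eq_zpow_neg_valuation (by exact_mod_cast hr0), Padic.valuation_ratCast, hunit, zpow_neg,
      zpow_one]
  exact norm_pow_sub_one_eq_of_norm_sub_le' hw1 huw hw

/-! ## §1. W2: `d(K_{x₀}) = (e + e/p − 1)/e` exactly -/

/-- **THE WILD DIFFERENT AT A W2 POLE, EXACT: `d(K_{x₀}) = (e + e/p − 1)/e`** at every fibre point `x₀ ∣ p ∈ {3,5}` (`p ≠ l`) of the pilot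
datum of a genuine Θ-volume datum at `(ratPoint q₀, l)`, over a pole of `j(q₀)` of order `2t` with `p ∣ t` and `v_p(u^{p−1} − 1) = 1`,
`u = j(q₀)⁻¹/p^{2t}`: abc-iut-W-neg-1's lower bound meets this seat's `differentOrd_le_of_pow_prime_eq_unit` (`p² ∤ e` by `v_p(e) ≤ 1`).
[cite: SerreLocalFields1979, Ch. III §6 Prop. 13; Cor. 2 of Prop. 11] [cite: Mochizuki2012, IUTchIV Prop. 1.3 (i) p. 11, Thm. 1.10 p. 22]
[claim: Mochizuki2012, status: disputed] -/
theorem GenuineK.differentOrd_kOf_eq_wildUnit_ratPoint {q₀ : ℚ} {l : ℕ}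
    (T : Cor22.ThetaVolumeDatumAt (ratPoint q₀) l)
    (pp : Nat.Primes) {p' : ℕ} (hpq : ((pp : ℕ) = 3 ∧ p' = 5) ∨ ((pp : ℕ) = 5 ∧ p' = 3)) (hpl : (pp : ℕ) ≠ l)
    {t : ℕ} (ht : 0 < t) (hpt : (pp : ℕ) ∣ t)
    (hpole : ∀ v : HeightOneSpectrum (𝓞 ℚ), Rat.HeightOneSpectrum.natGenerator v = pp →
      Literature.IUT.LogVolume.ord ℚ v (Cor22.jInv q₀) = -(2 * (t : ℤ)))
    (hunit : padicValRat pp ((((Cor22.jInv q₀)⁻¹ / ((pp : ℕ) : ℚ) ^ (2 * t)) ^ ((pp : ℕ) - 1) - 1)) = 1) :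
    letI := T.instFieldF; letI := T.instNumberFieldF; letI := T.instAlgebraF; letI := T.instFieldK
    letI := T.instNumberFieldK; letI := T.instAlgebraK; letI := T.instFieldFbar; letI := T.instAlgebraFbar
    letI := T.instAlgebraKFbar; letI := T.instIsElliptic
    haveI : Fact (pp : ℕ).Prime := ⟨pp.2⟩
    ∀ x₀ : (thetaIndex (pilotDataOfK T.D T.K)).Fibre (.inr pp),
      differentOrd (pp : ℕ) (kOf (pilotDataOfK T.D T.K) pp.1 x₀) =
        ((absRamificationIdx (pp : ℕ) (kOf (pilotDataOfK T.D T.K) pp.1 x₀) +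
              absRamificationIdx (pp : ℕ) (kOf (pilotDataOfK T.D T.K) pp.1 x₀) / pp - 1 : ℕ) : ℝ) /
          (absRamificationIdx (pp : ℕ) (kOf (pilotDataOfK T.D T.K) pp.1 x₀) : ℝ) := by
  letI := T.instFieldF; letI := T.instNumberFieldF; letI := T.instAlgebraF; letI := T.instFieldK
  letI := T.instNumberFieldK; letI := T.instAlgebraK; letI := T.instFieldFbar; letI := T.instAlgebraFbar
  letI := T.instAlgebraKFbar; letI := T.instIsElliptic
  haveI : Fact (pp : ℕ).Prime := ⟨pp.2⟩
  have hp30 : (pp : ℕ) ∣ 30 := by rcases hpq with ⟨h, -⟩ | ⟨h, -⟩ <;> rw [h] <;> norm_num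
  have hp2 : (pp : ℕ) ≠ 2 := by rcases hpq with ⟨h, -⟩ | ⟨h, -⟩ <;> omega
  intro x₀
  obtain ⟨u, y, hu1, huw, hy⟩ := GenuineK.exists_pow_prime_eq_unit_kOf_ratPoint T pp hp30 hp2 ht hpt hpole x₀
  have hu := norm_pow_sub_one_eq_of_norm_sub_le_of_padicValRat' (pp : ℕ) hu1 huw hunit
  have hv := GenuineK.padicValNat_absRamificationIdx_kOf_le_one_ratPoint T pp hpq hpl ht hpole x₀
  have he0 : absRamificationIdx (pp : ℕ) (kOf (pilotDataOfK T.D T.K) pp.1 x₀) ≠ 0 := (absRamificationIdx_pos (pp : ℕ) _).ne'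
  have he2 : ¬ (pp : ℕ) ^ 2 ∣ absRamificationIdx (pp : ℕ) (kOf (pilotDataOfK T.D T.K) pp.1 x₀) := by
    intro h
    have := (padicValNat_dvd_iff_le he0).mp h
    omega
  exact differentOrd_eq_of_pow_prime_eq_unit (pp : ℕ) hu hy he2

/-- **Global form, EXACT: `ord_u 𝔇_{K/ℤ} = e(u|p) + e(u|p)/p − 1`** at the place `u = placeOf x₀` under every W2 fibre point (`d(K_u) =
ord_u(𝔇_{K/ℤ})/e(u|p)`, the tree's `differentOrd_rescaledCompletion`). [cite: SerreLocalFields1979, Ch. III §4 Prop. 10, §6 Prop. 13]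
[cite: Mochizuki2012, IUTchIV Thm. 1.10 p. 22] [claim: Mochizuki2012, status: disputed] -/
theorem GenuineK.multiplicity_differentIdeal_placeOf_eq_wildUnit_ratPoint {q₀ : ℚ} {l : ℕ}
    (T : Cor22.ThetaVolumeDatumAt (ratPoint q₀) l)
    (pp : Nat.Primes) {p' : ℕ} (hpq : ((pp : ℕ) = 3 ∧ p' = 5) ∨ ((pp : ℕ) = 5 ∧ p' = 3)) (hpl : (pp : ℕ) ≠ l)
    {t : ℕ} (ht : 0 < t) (hpt : (pp : ℕ) ∣ t)
    (hpole : ∀ v : HeightOneSpectrum (𝓞 ℚ), Rat.HeightOneSpectrum.natGenerator v = pp →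
      Literature.IUT.LogVolume.ord ℚ v (Cor22.jInv q₀) = -(2 * (t : ℤ)))
    (hunit : padicValRat pp ((((Cor22.jInv q₀)⁻¹ / ((pp : ℕ) : ℚ) ^ (2 * t)) ^ ((pp : ℕ) - 1) - 1)) = 1) :
    letI := T.instFieldF; letI := T.instNumberFieldF; letI := T.instAlgebraF; letI := T.instFieldK
    letI := T.instNumberFieldK; letI := T.instAlgebraK; letI := T.instFieldFbar; letI := T.instAlgebraFbar
    letI := T.instAlgebraKFbar; letI := T.instIsElliptic
    haveI : Fact (pp : ℕ).Prime := ⟨pp.2⟩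
    ∀ x₀ : (thetaIndex (pilotDataOfK T.D T.K)).Fibre (.inr pp),
      multiplicity (placeOf (pilotDataOfK T.D T.K) pp.1 x₀).asIdeal (differentIdeal ℤ (𝓞 T.K)) =
        (placeOf (pilotDataOfK T.D T.K) pp.1 x₀).asIdeal.ramificationIdx ℤ +
          (placeOf (pilotDataOfK T.D T.K) pp.1 x₀).asIdeal.ramificationIdx ℤ / pp - 1 := by
  letI := T.instFieldF; letI := T.instNumberFieldF; letI := T.instAlgebraF; letI := T.instFieldK
  letI := T.instNumberFieldK; letI := T.instAlgebraK; letI := T.instFieldFbar; letI := T.instAlgebraFbar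
  letI := T.instAlgebraKFbar; letI := T.instIsElliptic
  haveI : Fact (pp : ℕ).Prime := ⟨pp.2⟩
  set X := pilotDataOfK T.D T.K with hXdef
  intro x₀
  set u := placeOf X pp.1 x₀ with hudef
  have hpu : ((pp : ℕ) : 𝓞 T.K) ∈ u.asIdeal := natCast_mem_placeOf X pp.1 x₀
  have h := GenuineK.differentOrd_kOf_eq_wildUnit_ratPoint T pp hpq hpl ht hpt hpole hunit x₀
  have he : absRamificationIdx (pp : ℕ) (kOf X pp.1 x₀) = u.asIdeal.ramificationIdx ℤ := by
    rw [show absRamificationIdx (pp : ℕ) (kOf X pp.1 x₀) =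
        absRamificationIdx (pp : ℕ) (RescaledCompletion T.K pp.1 (placeOf X pp.1 x₀) hpu) from rfl,
      absRamificationIdx_rescaledCompletion]
  have hd : differentOrd (pp : ℕ) (kOf X pp.1 x₀) =
      (multiplicity u.asIdeal (differentIdeal ℤ (𝓞 T.K)) : ℝ) / (u.asIdeal.ramificationIdx ℤ : ℝ) := by
    rw [show differentOrd (pp : ℕ) (kOf X pp.1 x₀) =
        differentOrd (pp : ℕ) (RescaledCompletion T.K pp.1 (placeOf X pp.1 x₀) hpu) from rfl,
      differentOrd_rescaledCompletion]
  rw [hd, he] at h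
  have he0 : (0 : ℝ) < (u.asIdeal.ramificationIdx ℤ : ℝ) := by exact_mod_cast Ideal.ramificationIdx_pos u.asIdeal ℤ
  rw [div_left_inj' he0.ne'] at h
  exact_mod_cast h

/-! ## §2. SPLIT: `p ∤ e`, `d(K_{x₀}) = (e − 1)/e` -/

/-- **THE DIFFERENT AT A SPLIT `p ∣ t` POLE: `p ∤ e` and `d(K_{x₀}) = (e − 1)/e`** (tame) at every fibre point `x₀ ∣ p ∈ {3,5}` (`p ≠ l`) over
a pole of order `2t`, `p ∣ t`, with `u^{p−1} = 1 ∨ v_p(u^{p−1} − 1) ≥ 2`: abc-iut-W-neg-1's exact type `e = (p−1)·r·l` has no factor `p`,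
so Serre III §6 Prop. 13 (tame case, `differentOrd_eq_of_not_dvd`). [cite: SerreLocalFields1979, Ch. III §6 Prop. 13]
[cite: Mochizuki2012, IUTchIV Thm. 1.10 p. 22] [claim: Mochizuki2012, status: disputed] -/
theorem GenuineK.differentOrd_kOf_eq_wildSplit_ratPoint {q₀ : ℚ} {l : ℕ}
    (T : Cor22.ThetaVolumeDatumAt (ratPoint q₀) l)
    (pp : Nat.Primes) {p' : ℕ} (hpq : ((pp : ℕ) = 3 ∧ p' = 5) ∨ ((pp : ℕ) = 5 ∧ p' = 3)) (hpl : (pp : ℕ) ≠ l)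
    {t : ℕ} (ht : 0 < t) (hpt : (pp : ℕ) ∣ t)
    (hpole : ∀ v : HeightOneSpectrum (𝓞 ℚ), Rat.HeightOneSpectrum.natGenerator v = pp →
      Literature.IUT.LogVolume.ord ℚ v (Cor22.jInv q₀) = -(2 * (t : ℤ)))
    (hsplit : ((Cor22.jInv q₀)⁻¹ / ((pp : ℕ) : ℚ) ^ (2 * t)) ^ ((pp : ℕ) - 1) = 1 ∨
      2 ≤ padicValRat pp ((((Cor22.jInv q₀)⁻¹ / ((pp : ℕ) : ℚ) ^ (2 * t)) ^ ((pp : ℕ) - 1) - 1))) :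
    letI := T.instFieldF; letI := T.instNumberFieldF; letI := T.instAlgebraF; letI := T.instFieldK
    letI := T.instNumberFieldK; letI := T.instAlgebraK; letI := T.instFieldFbar; letI := T.instAlgebraFbar
    letI := T.instAlgebraKFbar; letI := T.instIsElliptic
    haveI : Fact (pp : ℕ).Prime := ⟨pp.2⟩
    ∀ x₀ : (thetaIndex (pilotDataOfK T.D T.K)).Fibre (.inr pp),
      ¬ (pp : ℕ) ∣ absRamificationIdx (pp : ℕ) (kOf (pilotDataOfK T.D T.K) pp.1 x₀) ∧
      differentOrd (pp : ℕ) (kOf (pilotDataOfK T.D T.K) pp.1 x₀) =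
        ((absRamificationIdx (pp : ℕ) (kOf (pilotDataOfK T.D T.K) pp.1 x₀) : ℝ) - 1) /
          (absRamificationIdx (pp : ℕ) (kOf (pilotDataOfK T.D T.K) pp.1 x₀) : ℝ) := by
  letI := T.instFieldF; letI := T.instNumberFieldF; letI := T.instAlgebraF; letI := T.instFieldK
  letI := T.instNumberFieldK; letI := T.instAlgebraK; letI := T.instFieldFbar; letI := T.instAlgebraFbar
  letI := T.instAlgebraKFbar; letI := T.instIsElliptic
  haveI : Fact (pp : ℕ).Prime := ⟨pp.2⟩
  have hp : (pp : ℕ).Prime := pp.2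
  have h2 : 2 ≤ (pp : ℕ) := hp.two_le
  intro x₀
  have he := GenuineK.absRamificationIdx_kOf_eq_wildSplit_ratPoint T pp hpq hpl ht hpt hpole hsplit x₀
  -- the cofactor `(p−1)·r·l` is prime to `p`
  have hr : (p' / Nat.gcd p' t) ∣ p' := Nat.div_dvd_of_dvd (Nat.gcd_dvd_left p' t)
  have hpp' : ¬ (pp : ℕ) ∣ p' := by
    rcases hpq with ⟨h3, h5⟩ | ⟨h5, h3⟩
    · rw [h3, h5]; norm_num
    · rw [h5, h3]; norm_num
  have hndvd : ¬ (pp : ℕ) ∣ absRamificationIdx (pp : ℕ) (kOf (pilotDataOfK T.D T.K) pp.1 x₀) := by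
    rw [he]
    intro h
    rcases (Nat.Prime.dvd_mul hp).mp h with h | h
    · rcases (Nat.Prime.dvd_mul hp).mp h with h | h
      · exact Nat.not_dvd_of_pos_of_lt (by omega) (by omega) h
      · exact hpp' (h.trans hr)
    · exact hpl ((Nat.prime_dvd_prime_iff_eq hp T.D.l_prime).mp h)
  exact ⟨hndvd, differentOrd_eq_of_not_dvd (pp : ℕ) (kOf (pilotDataOfK T.D T.K) pp.1 x₀) hndvd⟩

/-- **Global form at a SPLIT pole: `ord_u 𝔇_{K/ℤ} = e(u|p) − 1`** (`u = placeOf x₀`; Mathlib's tame different theorem, read through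
`differentOrd_rescaledCompletion`). [cite: SerreLocalFields1979, Ch. III §4 Prop. 10, §6 Prop. 13] [cite: Mochizuki2012, IUTchIV Thm. 1.10 p. 22]
[claim: Mochizuki2012, status: disputed] -/
theorem GenuineK.multiplicity_differentIdeal_placeOf_eq_wildSplit_ratPoint {q₀ : ℚ} {l : ℕ}
    (T : Cor22.ThetaVolumeDatumAt (ratPoint q₀) l)
    (pp : Nat.Primes) {p' : ℕ} (hpq : ((pp : ℕ) = 3 ∧ p' = 5) ∨ ((pp : ℕ) = 5 ∧ p' = 3)) (hpl : (pp : ℕ) ≠ l)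
    {t : ℕ} (ht : 0 < t) (hpt : (pp : ℕ) ∣ t)
    (hpole : ∀ v : HeightOneSpectrum (𝓞 ℚ), Rat.HeightOneSpectrum.natGenerator v = pp →
      Literature.IUT.LogVolume.ord ℚ v (Cor22.jInv q₀) = -(2 * (t : ℤ)))
    (hsplit : ((Cor22.jInv q₀)⁻¹ / ((pp : ℕ) : ℚ) ^ (2 * t)) ^ ((pp : ℕ) - 1) = 1 ∨
      2 ≤ padicValRat pp ((((Cor22.jInv q₀)⁻¹ / ((pp : ℕ) : ℚ) ^ (2 * t)) ^ ((pp : ℕ) - 1) - 1))) :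
    letI := T.instFieldF; letI := T.instNumberFieldF; letI := T.instAlgebraF; letI := T.instFieldK
    letI := T.instNumberFieldK; letI := T.instAlgebraK; letI := T.instFieldFbar; letI := T.instAlgebraFbar
    letI := T.instAlgebraKFbar; letI := T.instIsElliptic
    haveI : Fact (pp : ℕ).Prime := ⟨pp.2⟩
    ∀ x₀ : (thetaIndex (pilotDataOfK T.D T.K)).Fibre (.inr pp),
      multiplicity (placeOf (pilotDataOfK T.D T.K) pp.1 x₀).asIdeal (differentIdeal ℤ (𝓞 T.K)) =
        (placeOf (pilotDataOfK T.D T.K) pp.1 x₀).asIdeal.ramificationIdx ℤ - 1 := by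
  letI := T.instFieldF; letI := T.instNumberFieldF; letI := T.instAlgebraF; letI := T.instFieldK
  letI := T.instNumberFieldK; letI := T.instAlgebraK; letI := T.instFieldFbar; letI := T.instAlgebraFbar
  letI := T.instAlgebraKFbar; letI := T.instIsElliptic
  haveI : Fact (pp : ℕ).Prime := ⟨pp.2⟩
  set X := pilotDataOfK T.D T.K with hXdef
  intro x₀
  set u := placeOf X pp.1 x₀ with hudef
  have hpu : ((pp : ℕ) : 𝓞 T.K) ∈ u.asIdeal := natCast_mem_placeOf X pp.1 x₀
  obtain ⟨-, h⟩ := GenuineK.differentOrd_kOf_eq_wildSplit_ratPoint T pp hpq hpl ht hpt hpole hsplit x₀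
  have he : absRamificationIdx (pp : ℕ) (kOf X pp.1 x₀) = u.asIdeal.ramificationIdx ℤ := by
    rw [show absRamificationIdx (pp : ℕ) (kOf X pp.1 x₀) =
        absRamificationIdx (pp : ℕ) (RescaledCompletion T.K pp.1 (placeOf X pp.1 x₀) hpu) from rfl,
      absRamificationIdx_rescaledCompletion]
  have hd : differentOrd (pp : ℕ) (kOf X pp.1 x₀) =
      (multiplicity u.asIdeal (differentIdeal ℤ (𝓞 T.K)) : ℝ) / (u.asIdeal.ramificationIdx ℤ : ℝ) := by
    rw [show differentOrd (pp : ℕ) (kOf X pp.1 x₀) =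
        differentOrd (pp : ℕ) (RescaledCompletion T.K pp.1 (placeOf X pp.1 x₀) hpu) from rfl,
      differentOrd_rescaledCompletion]
  rw [hd, he] at h
  have he1 : 1 ≤ u.asIdeal.ramificationIdx ℤ := Ideal.ramificationIdx_pos u.asIdeal ℤ
  have he0 : (0 : ℝ) < (u.asIdeal.ramificationIdx ℤ : ℝ) := by exact_mod_cast he1
  rw [div_left_inj' he0.ne'] at h
  have hcast : ((u.asIdeal.ramificationIdx ℤ : ℕ) : ℝ) - 1 = ((u.asIdeal.ramificationIdx ℤ - 1 : ℕ) : ℝ) := by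
    rw [Nat.cast_sub he1, Nat.cast_one]
  rw [hcast] at h
  exact_mod_cast h

/-! ## §3. The `p ∣ t` pole, decided by one congruence -/

/-- **THE WILD DIFFERENT AT A `p ∣ t` POLE, DECIDED BY ONE CONGRUENCE: `e·d(K_{x₀}) = if v_p(u^{p−1} − 1) = 1 then e + e/p − 1 else e − 1`**
at every fibre point `x₀ ∣ p ∈ {3, 5}` (`p ≠ l`) over a pole of order `2t`, `p ∣ t`, `u = j(q₀)⁻¹/p^{2t}` (W2 by §1; otherwise Fermat gives the
SPLIT alternative `u^{p−1} = 1 ∨ v_p(u^{p−1} − 1) ≥ 2`, abc-iut-W-neg-1's `GenuineK.padicValRat_pow_sub_one_sub_one_of_padicValRat_eq_zero`, and §2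
applies). Together with the W1 value `2e − 1` (`p ∤ t`, `GenuineK.differentOrd_kOf_eq_wild_ratPoint`) this is W-num-2's N1-WILD-EXACT table
`δ_w` at EVERY wild packet of a rational-point genuine datum — GAP G-Wnum2-1 (ii) two-sided in the kernel.
[cite: SerreLocalFields1979, Ch. III §6 Prop. 13] [cite: Serre1973, Ch. II §3.3] [cite: Mochizuki2012, IUTchIV Thm. 1.10 p. 22]
[claim: Mochizuki2012, status: disputed] -/
theorem GenuineK.mul_differentOrd_kOf_eq_wild_ite_ratPoint {q₀ : ℚ} {l : ℕ}
    (T : Cor22.ThetaVolumeDatumAt (ratPoint q₀) l)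
    (pp : Nat.Primes) {p' : ℕ} (hpq : ((pp : ℕ) = 3 ∧ p' = 5) ∨ ((pp : ℕ) = 5 ∧ p' = 3)) (hpl : (pp : ℕ) ≠ l)
    {t : ℕ} (ht : 0 < t) (hpt : (pp : ℕ) ∣ t)
    (hpole : ∀ v : HeightOneSpectrum (𝓞 ℚ), Rat.HeightOneSpectrum.natGenerator v = pp →
      Literature.IUT.LogVolume.ord ℚ v (Cor22.jInv q₀) = -(2 * (t : ℤ))) :
    letI := T.instFieldF; letI := T.instNumberFieldF; letI := T.instAlgebraF; letI := T.instFieldK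
    letI := T.instNumberFieldK; letI := T.instAlgebraK; letI := T.instFieldFbar; letI := T.instAlgebraFbar
    letI := T.instAlgebraKFbar; letI := T.instIsElliptic
    haveI : Fact (pp : ℕ).Prime := ⟨pp.2⟩
    ∀ x₀ : (thetaIndex (pilotDataOfK T.D T.K)).Fibre (.inr pp),
      (absRamificationIdx (pp : ℕ) (kOf (pilotDataOfK T.D T.K) pp.1 x₀) : ℝ) *
          differentOrd (pp : ℕ) (kOf (pilotDataOfK T.D T.K) pp.1 x₀) =
        ((if padicValRat pp ((((Cor22.jInv q₀)⁻¹ / ((pp : ℕ) : ℚ) ^ (2 * t)) ^ ((pp : ℕ) - 1) - 1)) = 1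
          then absRamificationIdx (pp : ℕ) (kOf (pilotDataOfK T.D T.K) pp.1 x₀) +
              absRamificationIdx (pp : ℕ) (kOf (pilotDataOfK T.D T.K) pp.1 x₀) / pp - 1
          else absRamificationIdx (pp : ℕ) (kOf (pilotDataOfK T.D T.K) pp.1 x₀) - 1 : ℕ) : ℝ) := by
  letI := T.instFieldF; letI := T.instNumberFieldF; letI := T.instAlgebraF; letI := T.instFieldK
  letI := T.instNumberFieldK; letI := T.instAlgebraK; letI := T.instFieldFbar; letI := T.instAlgebraFbar
  letI := T.instAlgebraKFbar; letI := T.instIsElliptic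
  haveI : Fact (pp : ℕ).Prime := ⟨pp.2⟩
  have hp : (pp : ℕ).Prime := pp.2
  intro x₀
  have he := absRamificationIdx_pos (pp : ℕ) (kOf (pilotDataOfK T.D T.K) pp.1 x₀)
  have he0 : (0 : ℝ) < (absRamificationIdx (pp : ℕ) (kOf (pilotDataOfK T.D T.K) pp.1 x₀) : ℝ) := by exact_mod_cast he
  by_cases h1 : padicValRat pp ((((Cor22.jInv q₀)⁻¹ / ((pp : ℕ) : ℚ) ^ (2 * t)) ^ ((pp : ℕ) - 1) - 1)) = 1
  · rw [if_pos h1, GenuineK.differentOrd_kOf_eq_wildUnit_ratPoint T pp hpq hpl ht hpt hpole h1 x₀, mul_div_cancel₀ _ he0.ne']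
  · rw [if_neg h1]
    -- the unit `u` has `v_p(u) = 0`, from the pole order at a place `v ∣ p`; Fermat gives the SPLIT alternative
    obtain ⟨v, hv⟩ : ∃ v : HeightOneSpectrum (𝓞 ℚ), Rat.HeightOneSpectrum.natGenerator v = pp :=
      ⟨(Rat.HeightOneSpectrum.primesEquiv (R := 𝓞 ℚ)).symm pp,
        congrArg (fun q : Nat.Primes => (q : ℕ)) ((Rat.HeightOneSpectrum.primesEquiv (R := 𝓞 ℚ)).apply_symm_apply pp)⟩
    have hord := hpole v hv
    have ht0 : (0 : ℤ) < t := by exact_mod_cast ht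
    have hj0 : Cor22.jInv q₀ ≠ 0 := fun h0 => by
      rw [h0, Literature.IUT.LogVolume.ord_zero] at hord
      linarith
    have hpQ : ((pp : ℕ) : ℚ) ≠ 0 := Nat.cast_ne_zero.mpr hp.ne_zero
    have hu0 : (Cor22.jInv q₀)⁻¹ / ((pp : ℕ) : ℚ) ^ (2 * t) ≠ 0 := div_ne_zero (inv_ne_zero hj0) (pow_ne_zero _ hpQ)
    have hu : padicValRat pp ((Cor22.jInv q₀)⁻¹ / ((pp : ℕ) : ℚ) ^ (2 * t)) = 0 := by
      have hvj : padicValRat pp (Cor22.jInv q₀) = -(2 * (t : ℤ)) := by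
        rw [← hv, ← GenuineK.ord_rat_eq_padicValRat v hj0]; exact hord
      rw [padicValRat.div (inv_ne_zero hj0) (pow_ne_zero _ hpQ), padicValRat.inv, hvj, padicValRat.pow,
        padicValRat.self hp.one_lt]
      push_cast; ring
    have hsplit : ((Cor22.jInv q₀)⁻¹ / ((pp : ℕ) : ℚ) ^ (2 * t)) ^ ((pp : ℕ) - 1) = 1 ∨
        2 ≤ padicValRat pp ((((Cor22.jInv q₀)⁻¹ / ((pp : ℕ) : ℚ) ^ (2 * t)) ^ ((pp : ℕ) - 1) - 1)) := by
      rcases GenuineK.padicValRat_pow_sub_one_sub_one_of_padicValRat_eq_zero (p := (pp : ℕ)) hu0 hu with h | h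
      · exact Or.inl h
      · right
        have h1' : padicValRat pp ((((Cor22.jInv q₀)⁻¹ / ((pp : ℕ) : ℚ) ^ (2 * t)) ^ ((pp : ℕ) - 1) - 1)) ≠ 1 := h1
        omega
    obtain ⟨-, hd⟩ := GenuineK.differentOrd_kOf_eq_wildSplit_ratPoint T pp hpq hpl ht hpt hpole hsplit x₀
    rw [hd, mul_div_cancel₀ _ he0.ne', Nat.cast_sub he, Nat.cast_one]

end Summit.ABC.IUTFork.Conditional

end
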